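import Mathlib
import HarnessLib

/-!
# Slice tools for the rate obstruction `NoFastBlowDown` (Tools B1)

Tools file B1 of the unconditional rate obstruction `NoFastBlowDown` for the witnesses of the crux
`Summit.AnomalousDissipation.AnomalousDissipation.Theses.DyadicWallCascade.ViscousContinuation`
(stmt-AnomalousDissipation-17917, line SketchIdeator4, lead c1).

The endgame of the rate obstruction is one-dimensional calculus in the height variable of
horizontal weighted averages of a smooth field `U : ℝ³ → ℝ³` (`ℝ³ = EuclideanSpace ℝ (Fin 3)`,
points `!₂[x, y, z]`, basis vectors `EuclideanSpace.single i 1`).  This file supplies: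

* `noFastBlowDown_hasDerivAt_along_line` — chain rule along an affine coordinate line;
* `noFastBlowDown_slice_hasDerivAt`, `noFastBlowDown_slice_hasDerivAt_vec`,
  `noFastBlowDown_slice_hasDerivAt_scalar` — slices of a `C¹` map along the three coordinate
  lines through `!₂[x, y, z]` have one-dimensional derivatives given by the partial derivatives
  `fderiv ℝ U !₂[x, y, z] (EuclideanSpace.single i 1)`;
* `noFastBlowDown_line_ibp` — weighted integration by parts on the line without boundary terms,
  `∫ k ⟪u, u″⟫ = -∫ k ‖u′‖² - ∫ k′ ⟪u, u′⟫` for compactly supported `C¹` weights `k`;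
* `noFastBlowDown_deriv_periodic` — the derivative of a `c`-periodic curve is `c`-periodic;
* `noFastBlowDown_fderiv_half_norm_sq` — `D(‖U‖² / 2)(X) v = ⟪U X, DU(X) v⟫`;
* `noFastBlowDown_fderiv_inner_fderiv` — the product rule
  `D⟪U, DU w⟫(X) v = ⟪DU(X) v, DU(X) w⟫ + ⟪U X, D(DU w)(X) v⟫` for `C²` fields.

All statements are folklore calculus; the file ends with the registered tools stub
`stub_noFastBlowDownSliceTools` (conjunction of the six statements).
-/

open MeasureTheory Set Filter Topology Function

set_option linter.dupNamespace false

noncomputable section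

namespace Summit.AnomalousDissipation.AnomalousDissipation.Theorems

/-! ## Slices along coordinate lines -/

/-- **Chain rule along an affine line.** If `L s = P + (s - a) • e` is an affine line in `ℝ³`
through `P = L a` with direction `e`, and `U` is differentiable at `P`, then `s ↦ U (L s)` has
derivative `DU(P) e` at `a`. [folklore] -/
theorem noFastBlowDown_hasDerivAt_along_line {F : Type*} [NormedAddCommGroup F] [NormedSpace ℝ F]
    (U : EuclideanSpace ℝ (Fin 3) → F) (L : ℝ → EuclideanSpace ℝ (Fin 3))
    (P e : EuclideanSpace ℝ (Fin 3)) (a : ℝ) (hL : ∀ s, L s = P + (s - a) • e)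
    (hU : DifferentiableAt ℝ U P) :
    HasDerivAt (fun s => U (L s)) (fderiv ℝ U P e) a := by
  obtain rfl : L = fun s => P + (s - a) • e := funext hL
  have hline : HasDerivAt (fun s : ℝ => P + (s - a) • e) e a := by
    simpa using (((hasDerivAt_id' a).sub_const a).smul_const e).const_add P
  exact hU.hasFDerivAt.comp_hasDerivAt_of_eq a hline (by simp)

/-- **Slices of a `C¹` map along coordinate lines.** For a `C¹` map `U` on `ℝ³` with values in
a normed space, the three slices `s ↦ U(s, y, z)`, `s ↦ U(x, s, z)`, `s ↦ U(x, y, s)` have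
derivatives at `x`, `y`, `z` given by the partial derivatives `DU(x, y, z) eᵢ`. [folklore] -/
theorem noFastBlowDown_slice_hasDerivAt {F : Type*} [NormedAddCommGroup F] [NormedSpace ℝ F]
    (U : EuclideanSpace ℝ (Fin 3) → F) (hU : ContDiff ℝ 1 U) (x y z : ℝ) :
    HasDerivAt (fun s : ℝ => U !₂[s, y, z])
        (fderiv ℝ U !₂[x, y, z] (EuclideanSpace.single 0 (1 : ℝ))) x ∧
      HasDerivAt (fun s : ℝ => U !₂[x, s, z])
        (fderiv ℝ U !₂[x, y, z] (EuclideanSpace.single 1 (1 : ℝ))) y ∧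
      HasDerivAt (fun s : ℝ => U !₂[x, y, s])
        (fderiv ℝ U !₂[x, y, z] (EuclideanSpace.single 2 (1 : ℝ))) z := by
  have hd : DifferentiableAt ℝ U !₂[x, y, z] := (hU.differentiable one_ne_zero) _
  refine ⟨noFastBlowDown_hasDerivAt_along_line U (fun s => !₂[s, y, z]) _ _ x ?_ hd,
    noFastBlowDown_hasDerivAt_along_line U (fun s => !₂[x, s, z]) _ _ y ?_ hd,
    noFastBlowDown_hasDerivAt_along_line U (fun s => !₂[x, y, s]) _ _ z ?_ hd⟩
  · intro s
    ext i
    fin_cases i <;> simp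
  · intro s
    ext i
    fin_cases i <;> simp
  · intro s
    ext i
    fin_cases i <;> simp

/-- **Slices of a `C¹` vector field along coordinate lines** (`ℝ³`-valued case of
`noFastBlowDown_slice_hasDerivAt`). [folklore] -/
theorem noFastBlowDown_slice_hasDerivAt_vec
    (U : EuclideanSpace ℝ (Fin 3) → EuclideanSpace ℝ (Fin 3)) (hU : ContDiff ℝ 1 U) (x y z : ℝ) :
    HasDerivAt (fun s : ℝ => U !₂[s, y, z])
        (fderiv ℝ U !₂[x, y, z] (EuclideanSpace.single 0 (1 : ℝ))) x ∧
      HasDerivAt (fun s : ℝ => U !₂[x, s, z])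
        (fderiv ℝ U !₂[x, y, z] (EuclideanSpace.single 1 (1 : ℝ))) y ∧
      HasDerivAt (fun s : ℝ => U !₂[x, y, s])
        (fderiv ℝ U !₂[x, y, z] (EuclideanSpace.single 2 (1 : ℝ))) z :=
  noFastBlowDown_slice_hasDerivAt U hU x y z

/-- **Slices of a `C¹` scalar field along coordinate lines** (real-valued case of
`noFastBlowDown_slice_hasDerivAt`). [folklore] -/
theorem noFastBlowDown_slice_hasDerivAt_scalar
    (G : EuclideanSpace ℝ (Fin 3) → ℝ) (hG : ContDiff ℝ 1 G) (x y z : ℝ) :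
    HasDerivAt (fun s : ℝ => G !₂[s, y, z])
        (fderiv ℝ G !₂[x, y, z] (EuclideanSpace.single 0 (1 : ℝ))) x ∧
      HasDerivAt (fun s : ℝ => G !₂[x, s, z])
        (fderiv ℝ G !₂[x, y, z] (EuclideanSpace.single 1 (1 : ℝ))) y ∧
      HasDerivAt (fun s : ℝ => G !₂[x, y, s])
        (fderiv ℝ G !₂[x, y, z] (EuclideanSpace.single 2 (1 : ℝ))) z :=
  noFastBlowDown_slice_hasDerivAt G hG x y z

/-! ## Weighted integration by parts on a line -/

/-- **Weighted integration by parts without boundary terms.** For a compactly supported `C¹`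
weight `k` (with derivative `k'`) and a `C²` curve `u` in `ℝ³` (with derivatives `u'`, `u''`,
the latter continuous), `∫ k ⟪u, u''⟫ = -∫ k ‖u'‖² - ∫ k' ⟪u, u'⟫`: the compactly supported
function `k ⟪u, u'⟫` has derivative `k' ⟪u, u'⟫ + k (⟪u, u''⟫ + ‖u'‖²)` of total integral
zero. [folklore] -/
theorem noFastBlowDown_line_ibp (k k' : ℝ → ℝ) (u u' u'' : ℝ → EuclideanSpace ℝ (Fin 3))
    (hk : Continuous k) (hk' : Continuous k') (hkc : HasCompactSupport k)
    (hkc' : HasCompactSupport k') (hkd : ∀ t, HasDerivAt k (k' t) t)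
    (hud : ∀ t, HasDerivAt u (u' t) t) (hud' : ∀ t, HasDerivAt u' (u'' t) t)
    (hu'' : Continuous u'') :
    ∫ t, k t * inner ℝ (u t) (u'' t) =
      -(∫ t, k t * ‖u' t‖ ^ 2) - ∫ t, k' t * inner ℝ (u t) (u' t) := by
  have hu : Continuous u := continuous_iff_continuousAt.2 fun t => (hud t).continuousAt
  have hu' : Continuous u' := continuous_iff_continuousAt.2 fun t => (hud' t).continuousAt
  -- the three integrands and the primitive are continuous with compact support
  have h1 : Integrable (fun t => k' t * inner ℝ (u t) (u' t)) :=
    (hk'.mul (hu.inner hu')).integrable_of_hasCompactSupport hkc'.mul_right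
  have h2 : Integrable (fun t => k t * inner ℝ (u t) (u'' t)) :=
    (hk.mul (hu.inner hu'')).integrable_of_hasCompactSupport hkc.mul_right
  have h3 : Integrable (fun t => k t * ‖u' t‖ ^ 2) :=
    (hk.mul ((hu'.norm).pow 2)).integrable_of_hasCompactSupport hkc.mul_right
  have h0 : Integrable (fun t => k t * inner ℝ (u t) (u' t)) :=
    (hk.mul (hu.inner hu')).integrable_of_hasCompactSupport hkc.mul_right
  -- derivative of the primitive `k ⟪u, u'⟫`
  have hderiv : ∀ t, HasDerivAt (fun t => k t * inner ℝ (u t) (u' t))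
      (k' t * inner ℝ (u t) (u' t) + (k t * inner ℝ (u t) (u'' t) + k t * ‖u' t‖ ^ 2)) t := by
    intro t
    refine ((hkd t).fun_mul ((hud t).inner ℝ (hud' t))).congr_deriv ?_
    rw [real_inner_self_eq_norm_sq]
    ring
  have h23 : Integrable (fun t => k t * inner ℝ (u t) (u'' t) + k t * ‖u' t‖ ^ 2) := h2.fun_add h3
  have hzero := integral_eq_zero_of_hasDerivAt_of_integrable hderiv (h1.fun_add h23) h0
  rw [integral_add h1 h23, integral_add h2 h3] at hzero
  linarith

/-! ## Periodicity of derivatives -/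

/-- **The derivative of a periodic curve is periodic.** If `u' ` is the derivative of `u`
everywhere and `u (t + c) = u t` for all `t`, then `u' (t + c) = u' t` (uniqueness of the
derivative applied to `t ↦ u (t + c)`). [folklore] -/
theorem noFastBlowDown_deriv_periodic (u u' : ℝ → EuclideanSpace ℝ (Fin 3)) (c : ℝ)
    (hud : ∀ t, HasDerivAt u (u' t) t) (hper : ∀ t, u (t + c) = u t) (t : ℝ) :
    u' (t + c) = u' t := by
  have h1 : HasDerivAt (fun s => u (s + c)) (u' (t + c)) t := (hud (t + c)).comp_add_const t c
  have h2 : (fun s => u (s + c)) = u := funext hper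
  rw [h2] at h1
  exact h1.unique (hud t)

/-! ## Derivatives of the kinetic energy density -/

/-- **Derivative of the kinetic energy density.** For a `C¹` field `U` on `ℝ³`,
`D(‖U‖² / 2)(X) v = ⟪U X, DU(X) v⟫`. [folklore] -/
theorem noFastBlowDown_fderiv_half_norm_sq
    (U : EuclideanSpace ℝ (Fin 3) → EuclideanSpace ℝ (Fin 3)) (hU : ContDiff ℝ 1 U)
    (X v : EuclideanSpace ℝ (Fin 3)) :
    fderiv ℝ (fun Y => ‖U Y‖ ^ 2 / 2) X v = inner ℝ (U X) (fderiv ℝ U X v) := by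
  have hd : DifferentiableAt ℝ U X := (hU.differentiable one_ne_zero) X
  have h1 : HasFDerivAt (fun Y => ‖U Y‖ ^ 2) (2 • (innerSL ℝ (U X)).comp (fderiv ℝ U X)) X :=
    hd.hasFDerivAt.norm_sq
  have hfun : (fun Y => ‖U Y‖ ^ 2 / 2) = fun Y => (2⁻¹ : ℝ) • ‖U Y‖ ^ 2 := by
    funext Y
    rw [smul_eq_mul, div_eq_inv_mul]
  rw [hfun, (h1.fun_const_smul (2⁻¹ : ℝ)).fderiv]
  simp

/-- **Product rule for `⟪U, DU w⟫`.** For a `C²` field `U` on `ℝ³` and fixed directions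
`v w`, `D(Y ↦ ⟪U Y, DU(Y) w⟫)(X) v = ⟪DU(X) v, DU(X) w⟫ + ⟪U X, D(Y ↦ DU(Y) w)(X) v⟫`;
here `Y ↦ DU(Y) w` is `C¹`. [folklore] -/
theorem noFastBlowDown_fderiv_inner_fderiv
    (U : EuclideanSpace ℝ (Fin 3) → EuclideanSpace ℝ (Fin 3)) (hU : ContDiff ℝ 2 U)
    (X v w : EuclideanSpace ℝ (Fin 3)) :
    fderiv ℝ (fun Y => inner ℝ (U Y) (fderiv ℝ U Y w)) X v =
      inner ℝ (fderiv ℝ U X v) (fderiv ℝ U X w) +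
        inner ℝ (U X) (fderiv ℝ (fun Y => fderiv ℝ U Y w) X v) := by
  have h1 : DifferentiableAt ℝ U X := (hU.differentiable two_ne_zero) X
  have h2 : DifferentiableAt ℝ (fun Y => fderiv ℝ U Y w) X := by
    have h : ContDiff ℝ 1 (fun Y => fderiv ℝ U Y w) :=
      (hU.fderiv_right (m := 1) le_rfl).clm_apply contDiff_const
    exact (h.differentiable one_ne_zero) X
  rw [fderiv_inner_apply ℝ h1 h2, add_comm]

/-! ## The registered tools stub -/

/-- **Tools B1 of the rate obstruction (registered stub).** Conjunction of the six folklore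
slice tools: coordinate-line slices of `C¹` vector and scalar fields on `ℝ³` have derivatives
given by the partial derivatives; weighted integration by parts on a line without boundary
terms; periodicity of derivatives of periodic curves; the derivative of `‖U‖² / 2`; and the
product rule for `⟪U, DU w⟫` for `C²` fields. [folklore] -/
theorem stub_noFastBlowDownSliceTools :
    (∀ (U : EuclideanSpace ℝ (Fin 3) → EuclideanSpace ℝ (Fin 3)), ContDiff ℝ 1 U →
      ∀ x y z : ℝ,
        HasDerivAt (fun s : ℝ => U !₂[s, y, z])
          (fderiv ℝ U !₂[x, y, z] (EuclideanSpace.single 0 (1 : ℝ))) x ∧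
        HasDerivAt (fun s : ℝ => U !₂[x, s, z])
          (fderiv ℝ U !₂[x, y, z] (EuclideanSpace.single 1 (1 : ℝ))) y ∧
        HasDerivAt (fun s : ℝ => U !₂[x, y, s])
          (fderiv ℝ U !₂[x, y, z] (EuclideanSpace.single 2 (1 : ℝ))) z) ∧
    (∀ (G : EuclideanSpace ℝ (Fin 3) → ℝ), ContDiff ℝ 1 G →
      ∀ x y z : ℝ,
        HasDerivAt (fun s : ℝ => G !₂[s, y, z])
          (fderiv ℝ G !₂[x, y, z] (EuclideanSpace.single 0 (1 : ℝ))) x ∧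
        HasDerivAt (fun s : ℝ => G !₂[x, s, z])
          (fderiv ℝ G !₂[x, y, z] (EuclideanSpace.single 1 (1 : ℝ))) y ∧
        HasDerivAt (fun s : ℝ => G !₂[x, y, s])
          (fderiv ℝ G !₂[x, y, z] (EuclideanSpace.single 2 (1 : ℝ))) z) ∧
    (∀ (k k' : ℝ → ℝ) (u u' u'' : ℝ → EuclideanSpace ℝ (Fin 3)),
      Continuous k → Continuous k' → HasCompactSupport k → HasCompactSupport k' →
      (∀ t, HasDerivAt k (k' t) t) → (∀ t, HasDerivAt u (u' t) t) →
      (∀ t, HasDerivAt u' (u'' t) t) → Continuous u'' →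
      ∫ t, k t * inner ℝ (u t) (u'' t) =
        -(∫ t, k t * ‖u' t‖ ^ 2) - ∫ t, k' t * inner ℝ (u t) (u' t)) ∧
    (∀ (u u' : ℝ → EuclideanSpace ℝ (Fin 3)) (c : ℝ), (∀ t, HasDerivAt u (u' t) t) →
      (∀ t, u (t + c) = u t) → ∀ t, u' (t + c) = u' t) ∧
    (∀ (U : EuclideanSpace ℝ (Fin 3) → EuclideanSpace ℝ (Fin 3)), ContDiff ℝ 1 U →
      ∀ (X v : EuclideanSpace ℝ (Fin 3)),
        fderiv ℝ (fun Y => ‖U Y‖ ^ 2 / 2) X v = inner ℝ (U X) (fderiv ℝ U X v)) ∧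
    (∀ (U : EuclideanSpace ℝ (Fin 3) → EuclideanSpace ℝ (Fin 3)), ContDiff ℝ 2 U →
      ∀ (X v w : EuclideanSpace ℝ (Fin 3)),
        fderiv ℝ (fun Y => inner ℝ (U Y) (fderiv ℝ U Y w)) X v =
          inner ℝ (fderiv ℝ U X v) (fderiv ℝ U X w) +
            inner ℝ (U X) (fderiv ℝ (fun Y => fderiv ℝ U Y w) X v)) :=
  ⟨noFastBlowDown_slice_hasDerivAt_vec, noFastBlowDown_slice_hasDerivAt_scalar,
    noFastBlowDown_line_ibp, noFastBlowDown_deriv_periodic, noFastBlowDown_fderiv_half_norm_sq,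
    noFastBlowDown_fderiv_inner_fderiv⟩

end Summit.AnomalousDissipation.AnomalousDissipation.Theorems

end
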